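import Mathlib.NumberTheory.Padics.PadicNumbers
import Mathlib.RingTheory.Coprime.Lemmas
import Literature.NumberTheory.NumberFields.PadicEmbeddingValuation

/-!
# `p`-adic numbers: which powers of `p` are `N`-th powers in `ℚ_p`

F. Q. Gouvêa, *p-adic Numbers: An Introduction* (Universitext, 1993) [Gouvea1993PadicNumbers], Lemma 4.1.2 (§4.1, render page p0062: «the p-adic valuation `v_p` extends to `ℚ_p`», `|x|_p = p^{-v_p(x)}`) with Lemma 2.1.3 (§2.1: `v_p(xy) = v_p(x) + v_p(y)`)
[cite: Gouvea1993PadicNumbers, Lemma 4.1.2]: in `ℚ_p` the power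
`p ^ k` (`k : ℤ`) is an `N`-th power iff `N ∣ k` (`N ≠ 0`), because `v_p(x ^ N) = N · v_p(x)` and `v_p(p) = 1`.
Stand-alone helper (abc-iut cell, seat abc-iut-w6-d061 gen 9; abc-iut-L2-lead R1249).  NAMED CONSUMER: abc-iut-L2-d1's
`Literature/AnabelianGeometry/EtaleTheta/Discharge/Sec2Rmk2141AlphaDeltaNoExtension.lean` ([EtTh] Rmk. 2.14.1 no-go at the
stage-2 model, FILE B of R1248), «Kummer injectivity mod `N`» step: an element `w ∈ ℚ_p` with `w ^ N = p ^ (m·u)`, `u` coprime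
to `N` — or `x ^ N = p ^ k · (unit)` — forces `N ∣ m` (resp. `N ∣ k`).  The special case `k = 1` («`p` is not an `ℓ`-th power,
`ℓ ≥ 2`») is ALREADY in the tree as `Padic.natCast_ne_pow` (`PadicAbsoluteGaloisGroupInfinite.lean`, Gouvêa Prop. 6.3.11) and is
not restated.  Proof-only; Mathlib's `Padic.valuation`, `Padic.valuation_pow`, `Padic.valuation_zpow`, `Padic.valuation_p`,
`Padic.norm_eq_zpow_neg_valuation` and the tree's `NumberFields.valuation_eq_zero_of_norm_eq_one` by name.
-/

namespace Literature.NumberTheory.LocalFields.PadicPrimePowerNthPowers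

variable {p : ℕ} [Fact p.Prime]

/-- If `x ^ N = p ^ k` in `ℚ_p` then `N · v_p(x) = k` (`v_p` multiplicative, `v_p(p) = 1`).
[cite: Gouvea1993PadicNumbers, Lemma 4.1.2 with Lemma 2.1.3] -/
theorem valuation_mul_eq_of_pow_eq_prime_zpow {x : ℚ_[p]} {N : ℕ} {k : ℤ}
    (h : x ^ N = (p : ℚ_[p]) ^ k) : (N : ℤ) * x.valuation = k := by
  have hv := congrArg Padic.valuation h
  rwa [Padic.valuation_pow, Padic.valuation_zpow, Padic.valuation_p, mul_one] at hv

/-- **`p ^ k` is an `N`-th power in `ℚ_p` iff `N ∣ k`** (`N ≠ 0`, `k : ℤ`) — immediate from `v_p(x^N) = N·v_p(x)`, `v_p(p^k) = k`.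
[cite: Gouvea1993PadicNumbers, Lemma 4.1.2 with Lemma 2.1.3] -/
theorem exists_pow_eq_prime_zpow_iff {N : ℕ} (hN : N ≠ 0) (k : ℤ) :
    (∃ x : ℚ_[p], x ^ N = (p : ℚ_[p]) ^ k) ↔ (N : ℤ) ∣ k := by
  constructor
  · rintro ⟨x, hx⟩
    exact ⟨x.valuation, (valuation_mul_eq_of_pow_eq_prime_zpow hx).symm⟩
  · rintro ⟨m, rfl⟩
    refine ⟨(p : ℚ_[p]) ^ m, ?_⟩
    have _ := hN
    rw [← zpow_natCast, ← zpow_mul, mul_comm]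

/-- Natural-number exponent form: `p ^ k` (`k : ℕ`) is an `N`-th power in `ℚ_p` iff `N ∣ k`.
[cite: Gouvea1993PadicNumbers, Lemma 4.1.2 with Lemma 2.1.3] -/
theorem exists_pow_eq_prime_pow_iff {N : ℕ} (hN : N ≠ 0) (k : ℕ) :
    (∃ x : ℚ_[p], x ^ N = (p : ℚ_[p]) ^ k) ↔ N ∣ k := by
  have h := exists_pow_eq_prime_zpow_iff (p := p) hN (k : ℤ)
  simp only [zpow_natCast, Int.natCast_dvd_natCast] at h
  exact h

/-- **Coprime-exponent form** (the shape used by Kummer-injectivity arguments): if `w ^ N = p ^ (m · u)` in `ℚ_p`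
with `u` coprime to `N`, then `N ∣ m` (`N·v_p(w) = m·u`).
[cite: Gouvea1993PadicNumbers, Lemma 4.1.2 with Lemma 2.1.3] -/
theorem dvd_of_pow_eq_prime_zpow_mul_coprime {w : ℚ_[p]} {N : ℕ} {m u : ℤ}
    (hu : IsCoprime u (N : ℤ)) (h : w ^ N = (p : ℚ_[p]) ^ (m * u)) : (N : ℤ) ∣ m := by
  have hNk : (N : ℤ) ∣ m * u := ⟨w.valuation, (valuation_mul_eq_of_pow_eq_prime_zpow h).symm⟩
  exact hu.symm.dvd_of_dvd_mul_right hNk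

/-- **Unit-times-power form** (abc-iut-L2-d1's requested variant): if `x ^ N = p ^ k · w` in `ℚ_p` with `‖w‖ = 1`, then `N ∣ k`
(`N·v_p(x) = k + v_p(w) = k`). [cite: Gouvea1993PadicNumbers, Lemma 4.1.2 with Lemma 2.1.3] -/
theorem dvd_of_pow_eq_prime_zpow_mul_unit {x w : ℚ_[p]} {N : ℕ} {k : ℤ} (hw : ‖w‖ = 1)
    (h : x ^ N = (p : ℚ_[p]) ^ k * w) : (N : ℤ) ∣ k := by
  have hw0 : w ≠ 0 := fun h0 => by rw [h0, norm_zero] at hw; exact zero_ne_one hw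
  have hp0 : (p : ℚ_[p]) ≠ 0 := Nat.cast_ne_zero.mpr (Fact.out : p.Prime).ne_zero
  have hpk : (p : ℚ_[p]) ^ k ≠ 0 := zpow_ne_zero k hp0
  have hv := congrArg Padic.valuation h
  rw [Padic.valuation_pow, Padic.valuation_mul hpk hw0, Padic.valuation_zpow, Padic.valuation_p, mul_one,
    Literature.NumberTheory.NumberFields.valuation_eq_zero_of_norm_eq_one hw, add_zero] at hv
  exact ⟨x.valuation, by rw [← hv, mul_comm]⟩

/-- **Norm form**: if `‖x‖ ^ N = p ^ k` (real `p`-adic norms, `k : ℤ`) then `N ∣ k` (for `x ≠ 0`, `‖x‖ = p^{-v_p(x)}`, so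
`-N·v_p(x) = k`; for `x = 0` the hypothesis forces `N = 0 = k`). [cite: Gouvea1993PadicNumbers, Lemma 4.1.2 with Lemma 2.1.3] -/
theorem dvd_of_norm_pow_eq_prime_zpow {x : ℚ_[p]} {N : ℕ} {k : ℤ} (h : ‖x‖ ^ N = (p : ℝ) ^ k) : (N : ℤ) ∣ k := by
  have hp1 : (1 : ℝ) < p := by exact_mod_cast (Fact.out : p.Prime).one_lt
  have hp0 : (0 : ℝ) < p := zero_lt_one.trans hp1
  have hinj := zpow_right_injective₀ hp0 hp1.ne'
  rcases eq_or_ne x 0 with rfl | hx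
  · rcases Nat.eq_zero_or_pos N with rfl | hN
    · rw [pow_zero] at h
      have hk : k = 0 := hinj (by simpa using h.symm)
      rw [hk]
      exact dvd_zero _
    · rw [norm_zero, zero_pow hN.ne'] at h
      exact absurd h.symm (zpow_ne_zero k hp0.ne')
  · rw [Padic.norm_eq_zpow_neg_valuation hx, ← zpow_natCast, ← zpow_mul] at h
    have hk : -x.valuation * (N : ℤ) = k := hinj h
    exact ⟨-x.valuation, by rw [← hk, mul_comm]⟩

/-- Negative form: if `¬ N ∣ k` then NO element of `ℚ_p` has `N`-th power `p ^ k`.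
[cite: Gouvea1993PadicNumbers, Lemma 4.1.2 with Lemma 2.1.3] -/
theorem pow_ne_prime_zpow_of_not_dvd {N : ℕ} {k : ℤ} (hk : ¬ (N : ℤ) ∣ k) (x : ℚ_[p]) :
    x ^ N ≠ (p : ℚ_[p]) ^ k := fun h =>
  hk ⟨x.valuation, (valuation_mul_eq_of_pow_eq_prime_zpow h).symm⟩

end Literature.NumberTheory.LocalFields.PadicPrimePowerNthPowers
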